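import Summits.BirchSwinnertonDyer.BirchSwinnertonDyer.Theorems.QuadraticBranchSignedControlPlusEtaNonsurjCartanField
import HarnessLib

/-!
# Route `QuadraticBranchSignedControl` (rung K8, cell `bsd-potss`): crux stmt-BirchSwinnertonDyer-19606
# `PlusEtaMainConjectureNonsurj` — A CM ANCHOR FORCES THE CARTAN FIELD OF A ROW TO BE ITS CM FIELD
# (part 2 of the kernel form of FINDING-19606-k8eta-c2-g5 §2 (c); the structure of the v7 stub «uncongruent»)

WHAT. Continuation of `…PlusEtaNonsurjCartanField` (the intrinsic Cartan subgroup `H_V = ρ̄⁻¹(C_ns(p))` of a row of crux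
19606: index `2`, frame-free as "centralises the squares on `V[p]`", a mod-`p` invariant). Here:

* §1 **CM anchors.** If `A[p]` carries a non-zero endomorphism `Ψ` with `Ψ(σP) = χ(σ)·σΨ(P)` for a non-trivial character
  `χ : Γ_ℚ → {±1}` — the shape of `[√D]` on a CM curve with CM field `K = ℚ(√D)` = `ker χ` (Lang, *Elliptic Functions*
  Ch. 10 §4 Remark: `σ[√D]σ⁻¹ = [σ√D]`; the tree's named fact `cmTorsion_cartanImage`, conjunct (5), whose derivation
  from `WeierstrassCurve.conj_mem_geomEndRing` / `not_hasRationalCM_holds` is recorded in that file's docstring) — and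
  `Im ρ̄_{A,p} = C_ns⁺(p)`, then `chi_eq_one_iff_matrix_mem_nonsplitCartan`: `ρ̄_A(σ) ∈ C_ns(ε) ⟺ χ(σ) = 1`, i.e. **the
  Cartan subgroup of a CM row is `Γ_K`** (the commutant of `Ψ` contains the squares, so `Ψ = u + v√ε`; an element with
  `χ = −1` anti-commutes with `Ψ`, forcing `u = 0`; `p ≠ 2`); frame-free form `centralizes_sq_iff_chi_eq_one`.
* §2 **consequence for the crux** `centralizes_sq_iff_chi_eq_one_of_modPCongruent`: a CM anchor `A` of `V`
  (`ModPCongruent V A p`) forces `H_V = Γ_K`, i.e. **`K_V` = the CM field of the anchor**; contrapositive CERTIFICATES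
  `not_modPCongruent_of_centralizes_sq_of_chi_ne_one` / `…_of_not_centralizes_sq_of_chi_eq_one`: ONE `σ ∈ Γ_ℚ` on which
  `H_V` and `Γ_K` disagree kills every CM anchor with CM field `K` — every model and every twist at once (g5 census,
  `p = 5`, height ≤ 20: 304/336 `X_ns⁺(5)` rows have `h(K_V) > 1`, 22 more the wrong cubic class — NO CM anchor; all 30
  in-table non-CM rows have `K_V = ℚ(√−3)` and ARE anchored, k8eta-c2 g8).
* §3 row-level wrapper `cartanSubgroup_eq_ker_of_cmAnchor_of_row` from the crux's own hypotheses.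

HONEST FRAMING (cell `bsd-potss`, run/shared/lean/pub/bsd-potss/; FULL-BSD rank ≤ 1 programme): TOOL THEOREMS ONLY
(no definition, no named fact, no `sorry`, axioms standard); the CM input is DISPLAYED as the hypothesis `(Ψ, χ)`
(its derivation for the thirteen CM `j`-invariants is CM theory — cited, not re-proved here). Nothing is booked; crux
19606 stays OPEN; `BSD(W, p)` is claimed for no pair. Seat `bsd-potss-k8eta-c2` g9 (prover),
`--supports stmt-BirchSwinnertonDyer-19606`.

References: [Lang1987] Ch. 10 §4 (Remark, Thm. 8); [Serre1972] §2.2, §4.5; [Zywina2015] Thm. 1.4;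
S. Frengley, arXiv:2111.05813, Lemma 28.
-/

set_option autoImplicit false
set_option linter.dupNamespace false

noncomputable section

open scoped Classical

open Matrix Field WeierstrassCurve Literature.NumberTheory.EllipticCurves Literature.NumberTheory.SerreUniformity
open Summit.BirchSwinnertonDyer.Rank1Residual.O6 (ModPCongruent)

namespace Summit.BirchSwinnertonDyer.BirchSwinnertonDyer.Theorems.EtaCartanField

variable {p : ℕ} [hp : Fact p.Prime]

/-! ## §1 CM anchors: a `√D`-structure pins the Cartan subgroup to `Γ_K` -/

section CM

variable {A : WeierstrassCurve ℚ}

/-- The matrix `Q` of an additive endomorphism `Ψ` of `A[p]` in the frame `e` (`Q v = e Ψ e⁻¹ v`). [folklore] -/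
private theorem exists_matrix_of_addMonoidEnd (e : A.geomTorsion p ≃+ (Fin 2 → ZMod p))
    (Ψ : AddMonoid.End (A.geomTorsion p)) :
    ∃ Q : Matrix (Fin 2) (Fin 2) (ZMod p), ∀ P : A.geomTorsion p, e (Ψ P) = Q.mulVec (e P) := by
  let g : (Fin 2 → ZMod p) →+ (Fin 2 → ZMod p) :=
    e.toAddMonoidHom.comp ((Ψ : A.geomTorsion p →+ A.geomTorsion p).comp e.symm.toAddMonoidHom)
  let gl : (Fin 2 → ZMod p) →ₗ[ZMod p] (Fin 2 → ZMod p) := g.toZModLinearMap p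
  refine ⟨LinearMap.toMatrix' gl, fun P => ?_⟩
  have h1 : (LinearMap.toMatrix' gl).mulVec (e P) = gl (e P) := by
    rw [← Matrix.toLin'_apply, Matrix.toLin'_toMatrix']
  rw [h1]
  change e (Ψ P) = e (Ψ (e.symm (e P)))
  rw [AddEquiv.symm_apply_apply]

/-- **On a row carrying a `√D`-structure the Cartan subgroup is the kernel of the CM character.** Let `Im ρ̄_{A,p} = C_ns⁺(ε)`
in the frame `e` (`p ≠ 2`), and let `Ψ ≠ 0` be an endomorphism of the group `A[p]` with `Ψ(σP) = χ(σ)·σΨ(P)` for a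
character `χ : Γ_ℚ → {±1}` which is not trivial — for a CM curve `A/ℚ` with CM field `K = ℚ(√D)`: `Ψ = [√D]`,
`χ = χ_K`, `ker χ = Γ_K` (Lang, Ch. 10 §4 Remark: `σ[√D]σ⁻¹ = [σ√D]`; the tree's `cmTorsion_cartanImage` (5)). Then for
every `σ`: `ρ̄(σ) ∈ C_ns(ε) ⟺ χ(σ) = 1`. PROOF: the matrix `Q` of `Ψ` commutes with `ρ̄(τ)` whenever `χ(τ) = 1`, in
particular with the square `(1 + √ε)²`, so `Q = u + v√ε` (commutant); some `σ₀` has `χ(σ₀) = −1`, and `ρ̄(σ₀)`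
anti-commutes with `Q`: if `ρ̄(σ₀) ∈ C_ns` this forces `Q = 0`; otherwise `ρ̄(σ₀)Q = Q̄ρ̄(σ₀)` (Frobenius) forces `u = 0`, so
`Q̄ = −Q`. Now `χ(σ) = −1` with `ρ̄(σ) ∈ C_ns` gives `2ρ̄(σ)Q = 0`, and `χ(σ) = 1` with `ρ̄(σ) ∉ C_ns` gives
`ρ̄(σ)Q = Q̄ρ̄(σ) = −Qρ̄(σ) = −ρ̄(σ)Q`; both contradict `Q ≠ 0`. [cite: Lang1987, Ch. 10 §4, Remark and Thm. 8]
[cite: Serre1972, §2.2 and §4.5] -/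
theorem chi_eq_one_iff_matrix_mem_nonsplitCartan (hp2 : p ≠ 2) (e : A.geomTorsion p ≃+ (Fin 2 → ZMod p))
    {ε : ZMod p} (hε : ¬ IsSquare ε)
    (himg : ∀ σ : absoluteGaloisGroup ℚ, ∃ M ∈ nonsplitCartanNormalizer ε,
      ∀ P : A.geomTorsion p, e (σ • P) = M.mulVec (e P))
    (hsurj : ∀ M ∈ nonsplitCartanNormalizer ε, ∃ σ : absoluteGaloisGroup ℚ,
      ∀ P : A.geomTorsion p, e (σ • P) = M.mulVec (e P))
    (χ : absoluteGaloisGroup ℚ →* ℤˣ) (hχ : ∃ σ : absoluteGaloisGroup ℚ, χ σ ≠ 1)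
    (Ψ : AddMonoid.End (A.geomTorsion p)) (hΨ0 : Ψ ≠ 0)
    (hΨ : ∀ (σ : absoluteGaloisGroup ℚ) (P : A.geomTorsion p), Ψ (σ • P) = ((χ σ : ℤˣ) : ℤ) • σ • Ψ P)
    {σ : absoluteGaloisGroup ℚ} {M : Matrix (Fin 2) (Fin 2) (ZMod p)} (hM : M ∈ nonsplitCartanNormalizer ε)
    (hσ : ∀ P : A.geomTorsion p, e (σ • P) = M.mulVec (e P)) :
    M ∈ nonsplitCartan ε ↔ χ σ = 1 := by
  have hε0 : ε ≠ 0 := fun h => hε ⟨0, by simp [h]⟩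
  have h2 : (2 : ZMod p) ≠ 0 := Ring.two_ne_zero (by rw [ZMod.ringChar_zmod_n]; exact hp2)
  obtain ⟨Q, hQ⟩ := exists_matrix_of_addMonoidEnd e Ψ
  -- `Q ≠ 0`
  have hQ0 : Q ≠ 0 := by
    intro hQ0
    apply hΨ0
    ext P
    have h1 := hQ P
    rw [hQ0, Matrix.zero_mulVec] at h1
    have h2' : e (Ψ P) = e 0 := by rw [h1, map_zero]
    exact congrArg Subtype.val (e.injective h2')
  -- equivariance in matrices: `χ τ = 1 ⇒ Q N = N Q`, `χ τ = -1 ⇒ Q N = -(N Q)`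
  have hcomm : ∀ (τ : absoluteGaloisGroup ℚ) (N : Matrix (Fin 2) (Fin 2) (ZMod p)),
      (∀ P : A.geomTorsion p, e (τ • P) = N.mulVec (e P)) → χ τ = 1 → Q * N = N * Q := by
    intro τ N hτ h1
    refine Matrix.mulVec_injective (funext fun v => ?_)
    have h3 := hΨ τ (e.symm v)
    rw [h1, Units.val_one, one_smul] at h3
    have h4 := congrArg e h3
    rw [hQ, hτ, hτ, hQ, AddEquiv.apply_symm_apply, Matrix.mulVec_mulVec, Matrix.mulVec_mulVec] at h4
    exact h4
  have hanti : ∀ (τ : absoluteGaloisGroup ℚ) (N : Matrix (Fin 2) (Fin 2) (ZMod p)),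
      (∀ P : A.geomTorsion p, e (τ • P) = N.mulVec (e P)) → χ τ ≠ 1 → Q * N = -(N * Q) := by
    intro τ N hτ h1
    have hm1 : χ τ = -1 := (Int.units_eq_one_or (χ τ)).resolve_left h1
    refine Matrix.mulVec_injective (funext fun v => ?_)
    have h3 := hΨ τ (e.symm v)
    rw [hm1, Units.val_neg, Units.val_one, neg_one_zsmul] at h3
    have h4 := congrArg e h3
    rw [hQ, hτ, map_neg, hτ, hQ, AddEquiv.apply_symm_apply, Matrix.mulVec_mulVec, Matrix.mulVec_mulVec,
      ← Matrix.neg_mulVec] at h4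
    exact h4
  -- `Q` commutes with the square `x²`, hence has the Cartan shape `u + v√ε`
  obtain ⟨τ, hτ⟩ := hsurj _ (nonsplitCartan_subset_normalizer ε (testElement_mem_nonsplitCartan ε))
  have hττ := matrix_mul e hτ hτ
  rw [testElement_sq] at hττ
  have hχττ : χ (τ * τ) = 1 := by rw [map_mul, Int.units_mul_self]
  have hQx := hcomm (τ * τ) _ hττ hχττ
  have hshape := eq_cartanShape_of_commute hε0 h2 hQx
  set u := Q 0 0 with hu
  set v := Q 1 0 with hv
  -- an anti-commuting `σ₀`: forces `u = 0`
  obtain ⟨σ₀, hσ₀⟩ := hχ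
  obtain ⟨M₀, hM₀, hMσ₀⟩ := himg σ₀
  have hQM₀ := hanti σ₀ M₀ hMσ₀ hσ₀
  have hu0 : u = 0 := by
    by_cases hM₀C : M₀ ∈ nonsplitCartan ε
    · -- `M₀ ∈ C_ns`: `Q` and `M₀` commute, so `2 M₀ Q = 0`, `Q = 0`
      exfalso
      obtain ⟨a, b, hab, rfl⟩ := hM₀C
      have hc : Q * !![a, ε * b; b, a] = !![a, ε * b; b, a] * Q := by
        rw [hshape]; exact cartanShape_mul_comm ε u v a b
      rw [hc] at hQM₀
      have hz : !![a, ε * b; b, a] * Q = 0 := eq_zero_of_add_self_eq_zero hp2 (by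
        nth_rewrite 1 [hQM₀]; exact neg_add_cancel _)
      exact hQ0 (eq_zero_of_normalizer_mul_eq_zero hε hM₀ hz)
    · obtain ⟨c, d, hcd, rfl⟩ := exists_eq_coset_of_not_mem_nonsplitCartan hM₀ hM₀C
      have hfrob : !![c, -(ε * d); d, -c] * Q = !![u, -(ε * v); -v, u] * !![c, -(ε * d); d, -c] := by
        rw [hshape]; exact coset_mul_cartanShape ε c d u v
      -- `Q M₀ = -(M₀ Q) = -(Q̄ M₀)` ⇒ `(Q + Q̄) M₀ = 0` ⇒ `Q + Q̄ = 0` ⇒ `2u = 0`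
      have hsum : (Q + !![u, -(ε * v); -v, u]) * !![c, -(ε * d); d, -c] = 0 := by
        rw [add_mul, ← hfrob, hQM₀, neg_add_cancel]
      have hsum0 := eq_zero_of_mul_normalizer_eq_zero hε hM₀ hsum
      have h00 := congrArg (fun N : Matrix (Fin 2) (Fin 2) (ZMod p) => N 0 0) hsum0
      simp only [Matrix.add_apply, Matrix.of_apply, Matrix.cons_val', Matrix.cons_val_zero,
        Matrix.cons_val_fin_one, Matrix.zero_apply] at h00
      have : (2 : ZMod p) * u = 0 := by linear_combination h00
      rcases mul_eq_zero.mp this with h | h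
      · exact absurd h h2
      · exact h
  have hshape0 : Q = !![0, ε * v; v, 0] := by rw [hshape, hu0]
  -- main equivalence
  constructor
  · intro hMC
    by_contra h1
    have hQM := hanti σ M hσ h1
    obtain ⟨a, b, hab, rfl⟩ := hMC
    have hc : Q * !![a, ε * b; b, a] = !![a, ε * b; b, a] * Q := by
      rw [hshape]; exact cartanShape_mul_comm ε u v a b
    rw [hc] at hQM
    have hz : !![a, ε * b; b, a] * Q = 0 := eq_zero_of_add_self_eq_zero hp2 (by
      nth_rewrite 1 [hQM]; exact neg_add_cancel _)
    exact hQ0 (eq_zero_of_normalizer_mul_eq_zero hε hM hz)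
  · intro h1
    by_contra hMC
    have hQM := hcomm σ M hσ h1
    obtain ⟨c, d, hcd, rfl⟩ := exists_eq_coset_of_not_mem_nonsplitCartan hM hMC
    have hfrob : !![c, -(ε * d); d, -c] * Q = !![0, -(ε * v); -v, 0] * !![c, -(ε * d); d, -c] := by
      rw [hshape0]
      have := coset_mul_cartanShape ε c d 0 v
      simpa using this
    have hnegQ : (!![0, -(ε * v); -v, 0] : Matrix (Fin 2) (Fin 2) (ZMod p)) = -Q := by
      rw [hshape0]; ext i j; fin_cases i <;> fin_cases j <;> simp
    rw [hnegQ, Matrix.neg_mul, ← hQM] at hfrob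
    -- `M Q = -(Q M) = -(M Q)` ⇒ `M Q = 0`
    have hz : !![c, -(ε * d); d, -c] * Q = 0 := eq_zero_of_add_self_eq_zero hp2 (by
      rw [← hQM]; nth_rewrite 1 [hfrob]; exact neg_add_cancel _)
    exact hQ0 (eq_zero_of_normalizer_mul_eq_zero hε hM hz)

/-- **Frame-free form**: on a row carrying a `√D`-structure `(Ψ, χ)`, `σ` centralises the squares on `A[p]` iff
`χ(σ) = 1` — the Cartan subgroup of a CM row IS `Γ_K`. [cite: Lang1987, Ch. 10 §4, Remark] [cite: Serre1972, §4.5] -/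
theorem centralizes_sq_iff_chi_eq_one (hp2 : p ≠ 2) (h : HasModPImageEqNonsplitCartanNormalizer A p)
    (χ : absoluteGaloisGroup ℚ →* ℤˣ) (hχ : ∃ σ : absoluteGaloisGroup ℚ, χ σ ≠ 1)
    (Ψ : AddMonoid.End (A.geomTorsion p)) (hΨ0 : Ψ ≠ 0)
    (hΨ : ∀ (σ : absoluteGaloisGroup ℚ) (P : A.geomTorsion p), Ψ (σ • P) = ((χ σ : ℤˣ) : ℤ) • σ • Ψ P)
    (σ : absoluteGaloisGroup ℚ) :
    (∀ (τ : absoluteGaloisGroup ℚ) (P : A.geomTorsion p), σ • ((τ * τ) • P) = (τ * τ) • (σ • P)) ↔ χ σ = 1 := by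
  obtain ⟨e, ε, hε, himg, hsurj⟩ := h
  obtain ⟨M, hM, hσ⟩ := himg σ
  rw [← matrix_mem_nonsplitCartan_iff_centralizes_sq hp2 e hε himg hsurj hM hσ]
  exact chi_eq_one_iff_matrix_mem_nonsplitCartan hp2 e hε himg hsurj χ hχ Ψ hΨ0 hΨ hM hσ

end CM

/-! ## §2 Consequence for the crux: a CM anchor forces `K_V = K` -/

/-- **A CM anchor pins the Cartan field.** If the row `V` is mod-`p` congruent to a curve `A` (`V[p] ≅ A[p]`
`Γ_ℚ`-equivariantly) whose image is `C_ns⁺(p)` and which carries a `√D`-structure `(Ψ, χ)` (CM by `K = ℚ(√D)`,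
`ker χ = Γ_K`), then for every `σ ∈ Γ_ℚ`: `σ` centralises the squares on `V[p]` ⟺ `χ(σ) = 1`. That is `H_V = Γ_K`:
**the Cartan field of `V` is the CM field of any CM anchor** — the kernel form of FINDING-19606-k8eta-c2-g5 §2 (c),
behind its census «no CM anchor unless `K_V ∈ {ℚ(√−2), ℚ(√−3), ℚ(√−7), ℚ(√−43), ℚ(√−67), ℚ(√−163)}` at `p = 5`».
[cite: Lang1987, Ch. 10 §4, Remark] [cite: Serre1972, §2.2 and §4.5] -/
theorem centralizes_sq_iff_chi_eq_one_of_modPCongruent (hp2 : p ≠ 2) {V A : WeierstrassCurve ℚ}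
    (hVA : ModPCongruent V A p) (hA : HasModPImageEqNonsplitCartanNormalizer A p)
    (χ : absoluteGaloisGroup ℚ →* ℤˣ) (hχ : ∃ σ : absoluteGaloisGroup ℚ, χ σ ≠ 1)
    (Ψ : AddMonoid.End (A.geomTorsion p)) (hΨ0 : Ψ ≠ 0)
    (hΨ : ∀ (σ : absoluteGaloisGroup ℚ) (P : A.geomTorsion p), Ψ (σ • P) = ((χ σ : ℤˣ) : ℤ) • σ • Ψ P)
    (σ : absoluteGaloisGroup ℚ) :
    (∀ (τ : absoluteGaloisGroup ℚ) (P : V.geomTorsion p), σ • ((τ * τ) • P) = (τ * τ) • (σ • P)) ↔ χ σ = 1 := by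
  rw [centralizes_sq_iff_of_modPCongruent hVA σ]
  exact centralizes_sq_iff_chi_eq_one hp2 hA χ hχ Ψ hΨ0 hΨ σ

/-- **Certificate (no CM anchor), first kind**: a single `σ ∈ Γ_ℚ` which centralises the squares on `V[p]`
(`ρ̄_V(σ) ∈ C_ns`, e.g. `Frob_ℓ` with `p ∤ a_ℓ(V)`) but lies OUTSIDE `Γ_K` (`χ_K(σ) ≠ 1`, e.g. `ℓ` inert in `K`) rules
out EVERY anchor `A` with image `C_ns⁺(p)` and a `√D`-structure for `χ_K` — all CM curves with CM field `K` at once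
(every model, every twist). [cite: Serre1972, §4.5] -/
theorem not_modPCongruent_of_centralizes_sq_of_chi_ne_one (hp2 : p ≠ 2) {V A : WeierstrassCurve ℚ}
    (hA : HasModPImageEqNonsplitCartanNormalizer A p)
    (χ : absoluteGaloisGroup ℚ →* ℤˣ) (Ψ : AddMonoid.End (A.geomTorsion p)) (hΨ0 : Ψ ≠ 0)
    (hΨ : ∀ (σ : absoluteGaloisGroup ℚ) (P : A.geomTorsion p), Ψ (σ • P) = ((χ σ : ℤˣ) : ℤ) • σ • Ψ P)
    {σ : absoluteGaloisGroup ℚ}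
    (hσ : ∀ (τ : absoluteGaloisGroup ℚ) (P : V.geomTorsion p), σ • ((τ * τ) • P) = (τ * τ) • (σ • P))
    (hχσ : χ σ ≠ 1) : ¬ ModPCongruent V A p := fun hVA =>
  hχσ ((centralizes_sq_iff_chi_eq_one_of_modPCongruent hp2 hVA hA χ ⟨σ, hχσ⟩ Ψ hΨ0 hΨ σ).mp hσ)

/-- **Certificate (no CM anchor), second kind**: a `σ ∈ Γ_K` (`χ_K(σ) = 1`) which does NOT centralise the squares on
`V[p]` (`ρ̄_V(σ) ∉ C_ns`, e.g. `Frob_ℓ` with `ℓ` split in `K` and `a_ℓ(V) ≡ 0`, `ρ̄_V(Frob_ℓ)` non-scalar of trace `0`)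
rules out every such anchor, provided `χ` is non-trivial. [cite: Serre1972, §4.5] -/
theorem not_modPCongruent_of_not_centralizes_sq_of_chi_eq_one (hp2 : p ≠ 2) {V A : WeierstrassCurve ℚ}
    (hA : HasModPImageEqNonsplitCartanNormalizer A p)
    (χ : absoluteGaloisGroup ℚ →* ℤˣ) (hχ : ∃ σ : absoluteGaloisGroup ℚ, χ σ ≠ 1)
    (Ψ : AddMonoid.End (A.geomTorsion p)) (hΨ0 : Ψ ≠ 0)
    (hΨ : ∀ (σ : absoluteGaloisGroup ℚ) (P : A.geomTorsion p), Ψ (σ • P) = ((χ σ : ℤˣ) : ℤ) • σ • Ψ P)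
    {σ : absoluteGaloisGroup ℚ}
    (hσ : ¬ ∀ (τ : absoluteGaloisGroup ℚ) (P : V.geomTorsion p), σ • ((τ * τ) • P) = (τ * τ) • (σ • P))
    (hχσ : χ σ = 1) : ¬ ModPCongruent V A p := fun hVA =>
  hσ ((centralizes_sq_iff_chi_eq_one_of_modPCongruent hp2 hVA hA χ hχ Ψ hΨ0 hΨ σ).mpr hχσ)

/-! ## §3 Row-level wrapper (hypotheses of the crux) -/

/-- **On every row of crux 19606, a CM anchor forces `K_V` = its CM field**: if the row `V` is mod-`p` congruent to a
curve `A` with image `C_ns⁺(p)` carrying a `√D`-structure `(Ψ ≠ 0, χ ≠ 1)`, then the Cartan subgroup of `V` is `ker χ`.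
So the v7 stub «non-CM rows NOT congruent to a CM row» contains every row whose Cartan field is not the CM field of a
CM curve over `ℚ` supersingular at `p` (`h(K_V) > 1` already suffices: g5 census 304/336 at height ≤ 20, `p = 5`).
[cite: Lang1987, Ch. 10 §4, Remark] [cite: Serre1972, §4.5] -/
theorem cartanSubgroup_eq_ker_of_cmAnchor_of_row (V : WeierstrassCurve ℚ) [V.IsElliptic] [V.IsGloballyMinimal]
    (p : ℕ) [Fact p.Prime] (hp5 : 5 ≤ p) (hgood : V.HasGoodReductionAtPrime p) (hap : V.frobeniusTrace p = 0)
    (hns : ¬ ∀ m : ℕ, V.HasSurjectiveModNGaloisRep (p ^ m : ℕ))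
    {A : WeierstrassCurve ℚ} (hVA : ModPCongruent V A p) (hA : HasModPImageEqNonsplitCartanNormalizer A p)
    (χ : absoluteGaloisGroup ℚ →* ℤˣ) (hχ : ∃ σ : absoluteGaloisGroup ℚ, χ σ ≠ 1)
    (Ψ : AddMonoid.End (A.geomTorsion p)) (hΨ0 : Ψ ≠ 0)
    (hΨ : ∀ (σ : absoluteGaloisGroup ℚ) (P : A.geomTorsion p), Ψ (σ • P) = ((χ σ : ℤˣ) : ℤ) • σ • Ψ P) :
    ∃ H : Subgroup (absoluteGaloisGroup ℚ), H.index = 2 ∧ H = χ.ker ∧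
      ∀ σ : absoluteGaloisGroup ℚ, σ ∈ H ↔
        ∀ (τ : absoluteGaloisGroup ℚ) (P : V.geomTorsion p), σ • ((τ * τ) • P) = (τ * τ) • (σ • P) := by
  obtain ⟨H, hH2, hH⟩ := exists_cartanSubgroup_of_row V p hp5 hgood hap hns
  refine ⟨H, hH2, ?_, hH⟩
  ext σ
  rw [hH σ, MonoidHom.mem_ker]
  exact centralizes_sq_iff_chi_eq_one_of_modPCongruent (by omega) hVA hA χ hχ Ψ hΨ0 hΨ σ


end Summit.BirchSwinnertonDyer.BirchSwinnertonDyer.Theorems.EtaCartanField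

end
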